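import Summits.ValiantsHypothesis.ValiantsHypothesis.Theorems.LacunarySymmetroidMatrixDescartesCensusDoorA34NodeRows

/-!
# `MatrixDescartes` census — DOOR A at `(3,4)`: `DoorA34` ⟸ the THREE-NODE LAWS — Cayley's row inside the linear family of
# cubics singular at three nodes

HONEST FRAMING.  Object-search cell `pub-symmetroid`, door-A seat `val-sym-door-p3` (g26); item stmt-ValiantsHypothesis-19980
`DoorA34 = PosRootLawAt 3 4 18` (route item `Theses.LacunarySymmetroid.DoorA34`) is OPEN and asserted nowhere in this file.  A REDUCTION,
not a proof: the door is implied by three explicit fewnomial row statements, two of which are NEW and LINEAR in a free node form.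

By `…NodeRows.doorA34_iff_nodeRows` the door is the conjunction of three row families on the node `K`-nomials `N(·) = Σ_l C(·_l)X^{d_l}`:
(R4) `Z₊(Σᵢ∏_{j≠i}N(ℓⱼ)) ≤ 18`, (R2) `Z₊((N(p)²+N(q)²)(N(ℓ₀)+N(ℓ₁)) + 2N(p)N(ℓ₀)N(ℓ₁)) ≤ 18`, (R0) `Z₊(N(r)(N(p)²+N(q)²) + N(p)(N(r)²+N(s)²)) ≤ 18`.
The identity (`e3_eq_threeNode`, any commutative ring)
  `e₃(ℓ₀,ℓ₁,ℓ₂,ℓ₃) = (ℓ₀+ℓ₁)(ℓ₀+ℓ₂)(ℓ₀+ℓ₃) − ℓ₀²·(ℓ₀+ℓ₁+ℓ₂+ℓ₃)`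
writes Cayley's four-nodal row as «a PRODUCT OF THREE node forms minus ℓ₀² times ONE node form», i.e. as the member `λ = e₁(ℓ)` of the LINEAR
family `{L₁L₂L₃ − L₀²·λ : λ a K-nomial}` — the family of cubic forms `y₁y₂y₃ − y₀²·λ(y)`, which are singular at the three vertices `e₁, e₂, e₃`
(partial degree `≤ 1` in `y₁, y₂, y₃`): THREE of Cayley's four nodes are kept, the fourth is the one linear condition «`λ = e₁`».  Likewise
(`R2_eq_threeNode`) the class-R2 row is `(ℓ₀+ℓ₁)·((ℓ₀+p)² + q²) − ℓ₀²·(ℓ₀+ℓ₁+2p)`, the member `λ = ℓ₀+ℓ₁+2p` of the linear family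
`{L₁·(A²+B²) − L₀²·λ}` (one real node and a conjugate pair kept).  Hence:

* `R4_rows_of_threeNodeRows` — on a support `d`, the THREE-NODE ROW `Z₊(N(L₁)N(L₂)N(L₃) − N(L₀)²N(λ)) ≤ 18` for all `4`-nomials
  `L₀,…,L₃,λ` on `d` IMPLIES the R4 row family on `d`;
* `R2_rows_of_threeNodeRowsC` — the MIXED THREE-NODE ROW `Z₊(N(L₁)(N(A)²+N(B)²) − N(L₀)²N(λ)) ≤ 18` implies the R2 row family on `d`;
* `posRootLawOn_of_threeNodeRows` — both three-node rows + the R0 rows on `d` ⟹ `PosRootLawOn 3 4 18 d`;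
* `doorA34_of_threeNodeLaws` — all supports: THREE-NODE LAW ∧ MIXED THREE-NODE LAW ∧ R0 rows ⟹ `DoorA34` (the cell's target `Census.DoorA34`,
  `Iff.rfl`-equal to the route item via `…Link.doorA34_item_iff`).

STATUS OF THE HYPOTHESES (honest): each three-node family is a `20`-nomial family with Descartes ceiling `19`; NEITHER law is proved or located
anywhere (no instrument has been run on them); they are STRONGER than the corresponding thirds of the door (one free `K`-nomial more) and are
offered as the cleaner targets of the node ladder (seat report `HOME/DOOR-A34-P3G26-REPORT.md` §1: rung one — ONE node — reaches `19`,
kernel `…NodalNineteen`; rungs two and three are open).  Nothing here bounds `ζ_sym(3,4)`; `DoorA34` stays OPEN; registers unchanged;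
nothing on `MatrixDescartes` (stmt-ValiantsHypothesis-18050) or on `VP ≠ VNP`.  [folklore] `ring` identities + the tree's node-row equivalence.
-/

-- `Summit.ValiantsHypothesis.ValiantsHypothesis.…` repeats a component by the D-0017 layout
-- (single-conjunct summit), which the `dupNamespace` linter flags; the name is mandated.
set_option linter.dupNamespace false

namespace Summit.ValiantsHypothesis.ValiantsHypothesis.Theorems.LacunarySymmetroidMatrixDescartes.Census.ThreeNodeLaw

open Polynomial Finset
open scoped BigOperators
open Summit.ValiantsHypothesis.ValiantsHypothesis.Theorems.MatrixDescartes.Negative (PosRootLawAt)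
open Summit.ValiantsHypothesis.ValiantsHypothesis.Theorems.LacunarySymmetroidMatrixDescartes.Census.EqualDiagonal
  (e3_eq_sum_prod_erase nodeForm_add posRootLawOn_iff_nodeRows doorA34_iff_nodeRows)

/-! ## 1. The three-node charts (ring identities) -/

/-- **CAYLEY = THREE PAIR SUMS MINUS A SQUARE TIMES THE TOTAL SUM**: `e₃(a,b,c,e) = (a+b)(a+c)(a+e) − a²(a+b+c+e)` in any commutative ring.
[folklore] -/
theorem e3_eq_threeNode {R : Type*} [CommRing R] (a b c e : R) :
    a * b * c + a * b * e + a * c * e + b * c * e = (a + b) * (a + c) * (a + e) - a ^ 2 * (a + b + c + e) := by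
  ring

/-- **Class R2 in three-node form**: `(p²+q²)(ℓ₀+ℓ₁) + 2pℓ₀ℓ₁ = (ℓ₀+ℓ₁)((ℓ₀+p)² + q²) − ℓ₀²(ℓ₀+ℓ₁+2p)` in any commutative ring. [folklore] -/
theorem R2_eq_threeNode {R : Type*} [CommRing R] (l₀ l₁ p q : R) :
    (p ^ 2 + q ^ 2) * (l₀ + l₁) + 2 * p * l₀ * l₁ = (l₀ + l₁) * ((l₀ + p) ^ 2 + q ^ 2) - l₀ ^ 2 * (l₀ + l₁ + (p + p)) := by
  ring

/-! ## 2. Three-node rows imply the R4 and R2 row families, support by support -/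

variable (d : Fin 4 → ℕ)

/-- **THREE-NODE ROWS ⟹ R4 ROWS** on a support `d`.  If `Z₊(N(L₁)N(L₂)N(L₃) − N(L₀)²N(λ)) ≤ 18` for all real `4`-nomials
`L₀, L₁, L₂, L₃, λ` on `d`, then every R4 node row `Σᵢ∏_{j≠i}N(ℓⱼ)` on `d` has `≤ 18` distinct positive roots
(take `L₀ = ℓ₀`, `Lⱼ = ℓ₀ + ℓⱼ`, `λ = ℓ₀+ℓ₁+ℓ₂+ℓ₃`). [folklore] -/
theorem R4_rows_of_threeNodeRows
    (h3 : ∀ L₀ L₁ L₂ L₃ lam : Fin 4 → ℝ,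
      (((∑ l, C (L₁ l) * (X : ℝ[X]) ^ d l) * (∑ l, C (L₂ l) * X ^ d l) * (∑ l, C (L₃ l) * X ^ d l)
          - (∑ l, C (L₀ l) * X ^ d l) ^ 2 * (∑ l, C (lam l) * X ^ d l)).roots.toFinset.filter (fun t => 0 < t)).card ≤ 18)
    (ℓ : Fin 4 → Fin 4 → ℝ) :
    ((∑ i, ∏ j ∈ Finset.univ.erase i, ∑ l, C (ℓ j l) * (X : ℝ[X]) ^ d l).roots.toFinset.filter (fun t => 0 < t)).card ≤ 18 := by
  rw [e3_eq_sum_prod_erase]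
  have key : (∑ l, C (ℓ 0 l) * (X : ℝ[X]) ^ d l) * (∑ l, C (ℓ 1 l) * X ^ d l) * (∑ l, C (ℓ 2 l) * X ^ d l)
        + (∑ l, C (ℓ 0 l) * X ^ d l) * (∑ l, C (ℓ 1 l) * X ^ d l) * (∑ l, C (ℓ 3 l) * X ^ d l)
        + (∑ l, C (ℓ 0 l) * X ^ d l) * (∑ l, C (ℓ 2 l) * X ^ d l) * (∑ l, C (ℓ 3 l) * X ^ d l)
        + (∑ l, C (ℓ 1 l) * X ^ d l) * (∑ l, C (ℓ 2 l) * X ^ d l) * (∑ l, C (ℓ 3 l) * X ^ d l)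
      = (∑ l, C (ℓ 0 l + ℓ 1 l) * (X : ℝ[X]) ^ d l) * (∑ l, C (ℓ 0 l + ℓ 2 l) * X ^ d l) * (∑ l, C (ℓ 0 l + ℓ 3 l) * X ^ d l)
        - (∑ l, C (ℓ 0 l) * X ^ d l) ^ 2 * (∑ l, C (ℓ 0 l + ℓ 1 l + ℓ 2 l + ℓ 3 l) * X ^ d l) := by
    have e3s : (∑ l, C (ℓ 0 l + ℓ 1 l + ℓ 2 l + ℓ 3 l) * (X : ℝ[X]) ^ d l)
        = (∑ l, C (ℓ 0 l) * X ^ d l) + (∑ l, C (ℓ 1 l) * X ^ d l) + (∑ l, C (ℓ 2 l) * X ^ d l) + ∑ l, C (ℓ 3 l) * X ^ d l := by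
      rw [← nodeForm_add d (ℓ 0) (ℓ 1)]
      rw [← nodeForm_add d (fun l => ℓ 0 l + ℓ 1 l) (ℓ 2)]
      rw [← nodeForm_add d (fun l => ℓ 0 l + ℓ 1 l + ℓ 2 l) (ℓ 3)]
    rw [nodeForm_add d (ℓ 0) (ℓ 1), nodeForm_add d (ℓ 0) (ℓ 2), nodeForm_add d (ℓ 0) (ℓ 3), e3s]
    exact e3_eq_threeNode _ _ _ _
  rw [key]
  simpa only [Pi.add_apply] using h3 (ℓ 0) (ℓ 0 + ℓ 1) (ℓ 0 + ℓ 2) (ℓ 0 + ℓ 3) (ℓ 0 + ℓ 1 + ℓ 2 + ℓ 3)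

/-- **MIXED THREE-NODE ROWS ⟹ R2 ROWS** on a support `d`.  If `Z₊(N(L₁)(N(A)²+N(B)²) − N(L₀)²N(λ)) ≤ 18` for all real `4`-nomials
`L₀, L₁, A, B, λ` on `d`, then every R2 node row `(N(p)²+N(q)²)(N(ℓ₀)+N(ℓ₁)) + 2N(p)N(ℓ₀)N(ℓ₁)` on `d` has `≤ 18` distinct positive roots
(take `L₀ = ℓ₀`, `L₁ = ℓ₀ + ℓ₁`, `A = ℓ₀ + p`, `B = q`, `λ = ℓ₀ + ℓ₁ + 2p`). [folklore] -/
theorem R2_rows_of_threeNodeRowsC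
    (h3 : ∀ L₀ L₁ A B lam : Fin 4 → ℝ,
      (((∑ l, C (L₁ l) * (X : ℝ[X]) ^ d l) * ((∑ l, C (A l) * X ^ d l) ^ 2 + (∑ l, C (B l) * X ^ d l) ^ 2)
          - (∑ l, C (L₀ l) * X ^ d l) ^ 2 * (∑ l, C (lam l) * X ^ d l)).roots.toFinset.filter (fun t => 0 < t)).card ≤ 18)
    (p q : Fin 4 → ℝ) (ℓ : Fin 2 → Fin 4 → ℝ) :
    ((((∑ l, C (p l) * (X : ℝ[X]) ^ d l) ^ 2 + (∑ l, C (q l) * X ^ d l) ^ 2)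
          * ((∑ l, C (ℓ 0 l) * X ^ d l) + (∑ l, C (ℓ 1 l) * X ^ d l))
        + 2 * (∑ l, C (p l) * X ^ d l) * (∑ l, C (ℓ 0 l) * X ^ d l) * (∑ l, C (ℓ 1 l) * X ^ d l)).roots.toFinset.filter
      (fun t => 0 < t)).card ≤ 18 := by
  have key : ((∑ l, C (p l) * (X : ℝ[X]) ^ d l) ^ 2 + (∑ l, C (q l) * X ^ d l) ^ 2)
          * ((∑ l, C (ℓ 0 l) * X ^ d l) + (∑ l, C (ℓ 1 l) * X ^ d l))
        + 2 * (∑ l, C (p l) * X ^ d l) * (∑ l, C (ℓ 0 l) * X ^ d l) * (∑ l, C (ℓ 1 l) * X ^ d l)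
      = (∑ l, C (ℓ 0 l + ℓ 1 l) * (X : ℝ[X]) ^ d l)
          * ((∑ l, C (ℓ 0 l + p l) * X ^ d l) ^ 2 + (∑ l, C (q l) * X ^ d l) ^ 2)
        - (∑ l, C (ℓ 0 l) * X ^ d l) ^ 2 * (∑ l, C (ℓ 0 l + ℓ 1 l + (p l + p l)) * X ^ d l) := by
    have es : (∑ l, C (ℓ 0 l + ℓ 1 l + (p l + p l)) * (X : ℝ[X]) ^ d l)
        = (∑ l, C (ℓ 0 l) * X ^ d l) + (∑ l, C (ℓ 1 l) * X ^ d l) + ((∑ l, C (p l) * X ^ d l) + ∑ l, C (p l) * X ^ d l) := by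
      rw [← nodeForm_add d (ℓ 0) (ℓ 1), ← nodeForm_add d p p]
      rw [← nodeForm_add d (fun l => ℓ 0 l + ℓ 1 l) (fun l => p l + p l)]
    rw [nodeForm_add d (ℓ 0) (ℓ 1), nodeForm_add d (ℓ 0) p, es]
    exact R2_eq_threeNode _ _ _ _
  rw [key]
  simpa only [Pi.add_apply] using h3 (ℓ 0) (ℓ 0 + ℓ 1) (ℓ 0 + p) q (ℓ 0 + ℓ 1 + (p + p))

/-! ## 3. The door from the three-node laws -/

/-- **`ζ(3,4; d) ≤ 18` ⟸ the two three-node rows and the R0 rows on `d`.** [folklore] -/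
theorem posRootLawOn_of_threeNodeRows
    (h3 : ∀ L₀ L₁ L₂ L₃ lam : Fin 4 → ℝ,
      (((∑ l, C (L₁ l) * (X : ℝ[X]) ^ d l) * (∑ l, C (L₂ l) * X ^ d l) * (∑ l, C (L₃ l) * X ^ d l)
          - (∑ l, C (L₀ l) * X ^ d l) ^ 2 * (∑ l, C (lam l) * X ^ d l)).roots.toFinset.filter (fun t => 0 < t)).card ≤ 18)
    (h3c : ∀ L₀ L₁ A B lam : Fin 4 → ℝ,
      (((∑ l, C (L₁ l) * (X : ℝ[X]) ^ d l) * ((∑ l, C (A l) * X ^ d l) ^ 2 + (∑ l, C (B l) * X ^ d l) ^ 2)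
          - (∑ l, C (L₀ l) * X ^ d l) ^ 2 * (∑ l, C (lam l) * X ^ d l)).roots.toFinset.filter (fun t => 0 < t)).card ≤ 18)
    (h0 : ∀ p q r s : Fin 4 → ℝ,
      (((∑ l, C (r l) * (X : ℝ[X]) ^ d l) * ((∑ l, C (p l) * X ^ d l) ^ 2 + (∑ l, C (q l) * X ^ d l) ^ 2)
          + (∑ l, C (p l) * X ^ d l) * ((∑ l, C (r l) * X ^ d l) ^ 2 + (∑ l, C (s l) * X ^ d l) ^ 2)).roots.toFinset.filter
        (fun t => 0 < t)).card ≤ 18) :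
    PosRootLawOn 3 4 18 d :=
  (posRootLawOn_iff_nodeRows d).mpr
    ⟨R4_rows_of_threeNodeRows d h3, fun p q ℓ => R2_rows_of_threeNodeRowsC d h3c p q ℓ, h0⟩

/-- **`DoorA34` ⟸ THREE-NODE LAW ∧ MIXED THREE-NODE LAW ∧ R0 ROWS (all supports).**  If on every support `d` and for all real `4`-nomials
on `d`: (i) `Z₊(N(L₁)N(L₂)N(L₃) − N(L₀)²N(λ)) ≤ 18`, (ii) `Z₊(N(L₁)(N(A)²+N(B)²) − N(L₀)²N(λ)) ≤ 18`, and (iii) the class-R0 rows are `≤ 18`,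
then the cell's target `DoorA34` holds.  (i) and (ii) are OPEN (Descartes ceiling `19`; located nowhere); (iii) is the R0 third of
`doorA34_iff_nodeRows`, OPEN. [folklore] -/
theorem doorA34_of_threeNodeLaws
    (h3 : ∀ (d : Fin 4 → ℕ) (L₀ L₁ L₂ L₃ lam : Fin 4 → ℝ),
      (((∑ l, C (L₁ l) * (X : ℝ[X]) ^ d l) * (∑ l, C (L₂ l) * X ^ d l) * (∑ l, C (L₃ l) * X ^ d l)
          - (∑ l, C (L₀ l) * X ^ d l) ^ 2 * (∑ l, C (lam l) * X ^ d l)).roots.toFinset.filter (fun t => 0 < t)).card ≤ 18)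
    (h3c : ∀ (d : Fin 4 → ℕ) (L₀ L₁ A B lam : Fin 4 → ℝ),
      (((∑ l, C (L₁ l) * (X : ℝ[X]) ^ d l) * ((∑ l, C (A l) * X ^ d l) ^ 2 + (∑ l, C (B l) * X ^ d l) ^ 2)
          - (∑ l, C (L₀ l) * X ^ d l) ^ 2 * (∑ l, C (lam l) * X ^ d l)).roots.toFinset.filter (fun t => 0 < t)).card ≤ 18)
    (h0 : ∀ (d : Fin 4 → ℕ) (p q r s : Fin 4 → ℝ),
      (((∑ l, C (r l) * (X : ℝ[X]) ^ d l) * ((∑ l, C (p l) * X ^ d l) ^ 2 + (∑ l, C (q l) * X ^ d l) ^ 2)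
          + (∑ l, C (p l) * X ^ d l) * ((∑ l, C (r l) * X ^ d l) ^ 2 + (∑ l, C (s l) * X ^ d l) ^ 2)).roots.toFinset.filter
        (fun t => 0 < t)).card ≤ 18) :
    DoorA34 :=
  doorA34_iff_nodeRows.mpr ⟨fun d => R4_rows_of_threeNodeRows d (h3 d), fun d p q ℓ => R2_rows_of_threeNodeRowsC d (h3c d) p q ℓ, h0⟩

end Summit.ValiantsHypothesis.ValiantsHypothesis.Theorems.LacunarySymmetroidMatrixDescartes.Census.ThreeNodeLaw
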